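import Summits.HodgeConjecture.HodgeConjecture.Theorems.F0LD1SameLabelRigidityOfIsotropic
import Summits.HodgeConjecture.HodgeConjecture.Theorems.F0LD1SameLabelRigidityOfSeparation
import HarnessLib

/-!
# LD letter «R₂» (★ `LemD1RankTwoCMLetters.LemD1_4SameLabelNonsplitCM₂`) FROM ONE ORGAN: the SEPARATION of the two transported rank-one theta lifts at the
# ANISOTROPIC non-split places — the closer of the R₂ in-house road (isotropic places discharged inside, splitting-free)

Cell `hodgecm-mathlib` (D-0151), FLOOR 0, half A line LD1 (socket `stub_S1_facts`, #73; R₂ is the shared letter stub `stub_letter_R₂` of BOTH LD leaves after the «T2 swap»,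
LD1 ED. 4 cand cd08770e ∕ LD2 ED. 4 b88ac399), seat LD1-p01 (g2), 2026-09-02.  THEOREMS ONLY; `--supports stmt-HodgeConjecture-24832`.

THE STATEMENT **`lemD1_4SameLabelNonsplitCM₂_of_forall_anisotropic_separation (hsepA) : LemD1_4SameLabelNonsplitCM₂`** — the booked letter R₂ ([Liu2021, Lem. D.1 (4)]
«only if», same label: `Θ_v(λ,a′,χ) ≠ 0 ∧ Θ_v(λ,a,χ) ≅ Θ_v(λ,a′,χ) ⇒ locF a v = locF a′ v` at every non-split `v`) follows from ONE hypothesis `hsepA` = «at every finite place `v` of `L⁺`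
NON-SPLIT in `L` where the plane `(L_v², diag dV)` is ANISOTROPIC, the two `e′_a`-transported CM sections `s_{a′}, s_a` (enumeration `Equiv.prodUnique (Fin 2) (Fin 1)`, model
`LocalMp L⁺ 2 (realDiagonal dV) v`, centre at `(a′)`) are SEPARATED: lines in different local classes → `Θ_{s_{a′}}(χ_v) ≠ 0` → `Θ_{s_{a′}}(χ_v) ≅ Θ_{s_a}(χ_v)` → `False`» (the body of
★ `rankOne_theta_lines_disjoint` there; binders = R₂'s own + the letter's weight-one + non-split + «not isotropic»).  PROOF: per place, `by_cases` on isotropy — isotropic: ★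
`F0LD1SameLabelRigidityOfIsotropic.locF_apply_eq_of_equiv_localTypes_nonsplit_of_isIsotropic` (p850003; splitting-free ★ `rankOne_theta_lines_disjoint_of_isotropic` inside, no letter,
no organ); anisotropic: ★ `F0LD1SameLabelRigidityOfSeparation.locF_apply_eq_of_equiv_localTypes_nonsplit_of_separation` (p850155) fed with `hsepA … v`.
CONSUMER SHAPE (LD leaves ED. 5, LD2-plan (g2) card v6 ∕ DEALS #3a): `stub_letter_R₂ := lemD1_4SameLabelNonsplitCM₂_of_forall_anisotropic_separation stub_organ`, the organ stub being
`hsepA`'s type (or anything implying it: LD2's road of record (P′) «opposite block-0 torus traces of the same-λ CM sections» ⟹ ★ thm A p850122 ⟹ ★ p850040 §2 ⟹ ★ p850028 §1 ⟹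
`hsepA`, composite pen LD2-p01 (g2)).  So after this file R₂'s in-house payment = EXACTLY the anisotropic separation, finitely many places per package.

HONEST LABEL.  Nothing of [Liu2021] is asserted; R₂ stays booked until `hsepA` is paid; HC_CM is proved only modulo the 7 printed citations (2 remaining: hLiu418 =
stmt-HodgeConjecture-24832, h413 = stmt-HodgeConjecture-24833) until rung 0 closes; count-neutral.

## References
* [Liu2021] Y. Liu, Camb. J. Math. 9 (2021) = arXiv:2102.11518 — App. D Lem. D.1 (4) (p. 126, TeX l. 5235) and its proof (l. 5257–5262); Rem. 4.2; Def. 4.12.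
* [MoeglinVignerasWaldspurger1987] C. Mœglin, M.-F. Vignéras, J.-L. Waldspurger, LNM 1291 (1987), Chap. 3 IV.2, IV.4.
* [HarrisKudlaSweet1996] M. Harris, S. Kudla, W. J. Sweet, J. AMS 9 (1996), Cor. 4.4, Thm. 6.1.
-/

set_option autoImplicit false
set_option linter.dupNamespace false

noncomputable section

open scoped Matrix Kronecker RestrictedProduct NumberField TensorProduct
open NumberField IsDedekindDomain Filter
open Literature.NumberTheory Literature.NumberTheory.Automorphic Literature.NumberTheory.Automorphic.UnitaryGroup
open Literature.NumberTheory.GelbartRogawski1991 Literature.NumberTheory.GelbartRogawski1991.UnitaryDualPair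
open Literature.NumberTheory.GelbartRogawski1991.UnitaryDualPair.WeilCoinv
open Literature.NumberTheory.GelbartRogawski1991.UnitaryDualPair.LocalSplitting
open Literature.NumberTheory.GelbartRogawski1991.GRConstruction
open Literature.NumberTheory.Weil1964 Literature.RepresentationTheory
open Literature.RepresentationTheory.HeisenbergGroup
open Literature.NumberTheory.GaloisRepresentations Literature.RepresentationTheory.HarrisKudlaSweet1996
open Literature.NumberTheory.Automorphic.IdeleClassGroup Literature.RepresentationTheory.Liu2021
open Literature.NumberTheory.Automorphic.Liu2021 Literature.NumberTheory.Automorphic.Liu2021.Def411WeilCarriers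
open Literature.NumberTheory.Automorphic.Liu2021.Def411WeilCarriersDoubling
open Literature.NumberTheory.Automorphic.Liu2021.LemD1RankTwoCMLetters
open Summit.HodgeConjecture.HodgeConjecture.Cruxes.HLiu418.F0LD1SameLabelRigidityOfIsotropic
open Summit.HodgeConjecture.HodgeConjecture.Cruxes.HLiu418.F0LD1SameLabelRigidityOfSeparation

namespace Summit.HodgeConjecture.HodgeConjecture.Cruxes.HLiu418.F0LD1SameLabelRigidityOfOrgan

set_option synthInstance.maxHeartbeats 400000 in
set_option maxHeartbeats 4000000 in -- the CM θ-package terms of the letter's binders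
/-- **R₂ FROM THE ANISOTROPIC SEPARATION ALONE.**  The booked letter ★ `LemD1_4SameLabelNonsplitCM₂` ([Liu2021, Lem. D.1 (4)] «only if», same label, rank-2 CM θ-packages, every
non-split place) follows from `hsepA` = the separation of the two `e′_a`-transported CM sections at every ANISOTROPIC non-split place (the body of ★ `rankOne_theta_lines_disjoint` there,
orientation «`a ≁_v a′` → `Θ_{s_{a′}} ≠ 0` → `Θ_{s_{a′}} ≅ Θ_{s_a}` → `False`»): per place, isotropic ⇒ ★ p850003 (splitting-free, ★ `rankOne_theta_lines_disjoint_of_isotropic`), anisotropic ⇒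
★ p850155 with `hsepA`.  `L_v` need not be assumed a field (non-split is among the binders handed to `hsepA`).
[cite: Liu2021, App. D Lemma D.1 (4) (p. 126, l. 5235), proof l. 5257–5262; Rem. 4.2] [cite: MoeglinVignerasWaldspurger1987, Chap. 3 IV.2, IV.4]
[cite: HarrisKudlaSweet1996, Cor. 4.4, Thm. 6.1] -/
theorem lemD1_4SameLabelNonsplitCM₂_of_forall_anisotropic_separation
    (hsepA : ∀ (L : Type) [Field L] [NumberField L] [IsCMField L]
        (dV : Fin 2 → L) (hdV : ∀ i, IsCMField.complexConj L (dV i) = dV i) (hdV0 : ∀ i, dV i ≠ 0)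
        (lam : Literature.NumberTheory.Automorphic.IdeleClassGroup L →ₜ* Circle) (hlam : IsConjugateSymplectic L lam),
        HasWeight L lam 1 →
      ∀ (a a' : (↥(maximalRealSubfield L))ˣ) (χ : Chi (↥(maximalRealSubfield L)) L (IsCMField.complexConj L))
        (v : HeightOneSpectrum (𝓞 (↥(maximalRealSubfield L)))),
        (∀ w : UnitaryGroup.PlacesOver L v, IsCMField.complexConj L • (w : HeightOneSpectrum (𝓞 L)) = w) →
        ¬ LemD1.IsIsotropic (LemD1OfPlace.standingData L v (IsCMField.complexConj L) 2 (Matrix.diagonal dV) (complexConj_imagUnit L)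
          (imagUnit_ne_zero L) le_rfl
          (transpose_map_conj_JV (Fp L) L (IsCMField.complexConj L) 2 (Matrix.diagonal dV) (realDiagonal_isSymm L dV hdV) (realDiagonal_map L dV hdV).symm)
          (det_JV_ne_zero (Fp L) L 2 (Matrix.diagonal dV) (isUnit_det_realDiagonal L dV hdV hdV0) (realDiagonal_map L dV hdV).symm)) →
      (¬ ∃ x : (LocalRing L v)ˣ, LemD1OfPlace.eps L v (lineDelta_ne_zero (imagUnit_ne_zero L) a) =
        x * Units.map (conjLocal L (IsCMField.complexConj L) v : LocalRing L v →* LocalRing L v) x * LemD1OfPlace.eps L v (lineDelta_ne_zero (imagUnit_ne_zero L) a')) →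
      Nontrivial (TwistedCoinv.Coinv
        ((show Representation ℂ (localPi L (IsCMField.complexConj L) 1 (JW (Fp L) L a') v) (SchwartzBruhat (Fin 2 → v.adicCompletion (Fp L))) from
          ((MpPsi.toRep (localSchrodinger (Fp L) 2 (realDiagonal L dV hdV) v)).comp (lineTransportSection (Fp L) L (IsCMField.complexConj L) 2 (complexConj_imagUnit L) (imagUnit_ne_zero L) (imagUnit_mul_self L) (realDiagonal L dV hdV) (realDiagonal_isSymm L dV hdV) (Matrix.diagonal dV) (realDiagonal_map L dV hdV).symm a' v ((congrW L (Equiv.prodUnique (Fin 2) (Fin 1)) dV hdV (lineW L (TW (Fp L) a')) (complexConj_lineW L (TW (Fp L) a')) (realDiagonal_lineW L (TW (Fp L) a')) (diagonal_lineW L (TW (Fp L) a') (JW_eq (Fp L) L a')) (undoubledSplittings L (Equiv.prodUnique (Fin 2) (Fin 1)) dV hdV hdV0 (lineW L (TW (Fp L) a')) (complexConj_lineW L (TW (Fp L) a')) (lineW_ne_zero L (TW (Fp L) a') (isUnit_det_TW (Fp L) a')) (toHeckeCharacter L lam) (borelPlaceMeasure L) (cmFinLocalFamily L (Equiv.prodUnique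 (Fin 2) (Fin 1)) dV hdV hdV0 (lineW L (TW (Fp L) a')) (complexConj_lineW L (TW (Fp L) a')) (lineW_ne_zero L (TW (Fp L) a') (isUnit_det_TW (Fp L) a')) (toHeckeCharacter L lam) ((isOscillatorChar_toHeckeCharacter_iff lam).mpr hlam) (borelPlaceMeasure L))) (isSymm_TW (Fp L) a') (JW_eq (Fp L) L a')).s v) ((congrW L (Equiv.prodUnique (Fin 2) (Fin 1)) dV hdV (lineW L (TW (Fp L) a')) (complexConj_lineW L (TW (Fp L) a')) (realDiagonal_lineW L (TW (Fp L) a')) (diagonal_lineW L (TW (Fp L) a') (JW_eq (Fp L) L a')) (undoubledSplittings L (Equiv.prodUnique (Fin 2) (Fin 1)) dV hdV hdV0 (lineW L (TW (Fp L) a')) (complexConj_lineW L (TW (Fp L) a')) (lineW_ne_zero L (TW (Fp L) a') (isUnit_det_TW (Fp L) a')) (toHeckeCharacter L lam) (borelPlaceMeasure L) (cmFinLocalFamily L (Equiv.prodUnique (Fin 2) (Fin 1)) dV hdV hdV0 (lineW L (TW (Fp L) a')) (complexConj_lineW L (TW (Fp L) a')) (lineW_ne_zero L (TW (Fp L) a')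 (isUnit_det_TW (Fp L) a')) (toHeckeCharacter L lam) ((isOscillatorChar_toHeckeCharacter_iff lam).mpr hlam) (borelPlaceMeasure L))) (isSymm_TW (Fp L) a') (JW_eq (Fp L) L a')).proj_s v))).comp (localCenter L (IsCMField.complexConj L) 2 (Matrix.diagonal dV) (JW (Fp L) L a') (JW_apply_ne_zero (Fp L) L a') v)))
        (localCharOfCenter (Fp L) L (IsCMField.complexConj L) (JW (Fp L) L a') (JW_apply_ne_zero (Fp L) L a') χ.1 v)) →
      AreIsomorphicRep
        (TwistedCoinv.rep
          (ρW := show Representation ℂ (localPi L (IsCMField.complexConj L) 1 (JW (Fp L) L a') v) (SchwartzBruhat (Fin 2 → v.adicCompletion (Fp L))) from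
            ((MpPsi.toRep (localSchrodinger (Fp L) 2 (realDiagonal L dV hdV) v)).comp (lineTransportSection (Fp L) L (IsCMField.complexConj L) 2 (complexConj_imagUnit L) (imagUnit_ne_zero L) (imagUnit_mul_self L) (realDiagonal L dV hdV) (realDiagonal_isSymm L dV hdV) (Matrix.diagonal dV) (realDiagonal_map L dV hdV).symm a' v ((congrW L (Equiv.prodUnique (Fin 2) (Fin 1)) dV hdV (lineW L (TW (Fp L) a')) (complexConj_lineW L (TW (Fp L) a')) (realDiagonal_lineW L (TW (Fp L) a')) (diagonal_lineW L (TW (Fp L) a') (JW_eq (Fp L) L a')) (undoubledSplittings L (Equiv.prodUnique (Fin 2) (Fin 1)) dV hdV hdV0 (lineW L (TW (Fp L) a')) (complexConj_lineW L (TW (Fp L) a')) (lineW_ne_zero L (TW (Fp L) a') (isUnit_det_TW (Fp L) a')) (toHeckeCharacter L lam) (borelPlaceMeasure L) (cmFinLocalFamily L (Equiv.prodUnique (Fin 2) (Fin 1)) dV hdV hdV0 (lineW L (TW (Fp L) a')) (complexConj_lineW L (TW (Fp L) a')) (lineW_ne_zero L (TW (Fp L) a') (isUnit_det_TW (Fp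 L) a')) (toHeckeCharacter L lam) ((isOscillatorChar_toHeckeCharacter_iff lam).mpr hlam) (borelPlaceMeasure L))) (isSymm_TW (Fp L) a') (JW_eq (Fp L) L a')).s v) ((congrW L (Equiv.prodUnique (Fin 2) (Fin 1)) dV hdV (lineW L (TW (Fp L) a')) (complexConj_lineW L (TW (Fp L) a')) (realDiagonal_lineW L (TW (Fp L) a')) (diagonal_lineW L (TW (Fp L) a') (JW_eq (Fp L) L a')) (undoubledSplittings L (Equiv.prodUnique (Fin 2) (Fin 1)) dV hdV hdV0 (lineW L (TW (Fp L) a')) (complexConj_lineW L (TW (Fp L) a')) (lineW_ne_zero L (TW (Fp L) a') (isUnit_det_TW (Fp L) a')) (toHeckeCharacter L lam) (borelPlaceMeasure L) (cmFinLocalFamily L (Equiv.prodUnique (Fin 2) (Fin 1)) dV hdV hdV0 (lineW L (TW (Fp L) a')) (complexConj_lineW L (TW (Fp L) a')) (lineW_ne_zero L (TW (Fp L) a') (isUnit_det_TW (Fp L) a')) (toHeckeCharacter L lam) ((isOscillatorChar_toHeckeCharacter_iff lam).mpr hlam) (borelPlaceMeasure L))) (isSymm_TW (Fp L) a') (JW_eq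 (Fp L) L a')).proj_s v))).comp (localCenter L (IsCMField.complexConj L) 2 (Matrix.diagonal dV) (JW (Fp L) L a') (JW_apply_ne_zero (Fp L) L a') v))
          (localCharOfCenter (Fp L) L (IsCMField.complexConj L) (JW (Fp L) L a') (JW_apply_ne_zero (Fp L) L a') χ.1 v)
          ((MpPsi.toRep (localSchrodinger (Fp L) 2 (realDiagonal L dV hdV) v)).comp (lineTransportSection (Fp L) L (IsCMField.complexConj L) 2 (complexConj_imagUnit L) (imagUnit_ne_zero L) (imagUnit_mul_self L) (realDiagonal L dV hdV) (realDiagonal_isSymm L dV hdV) (Matrix.diagonal dV) (realDiagonal_map L dV hdV).symm a' v ((congrW L (Equiv.prodUnique (Fin 2) (Fin 1)) dV hdV (lineW L (TW (Fp L) a')) (complexConj_lineW L (TW (Fp L) a')) (realDiagonal_lineW L (TW (Fp L) a')) (diagonal_lineW L (TW (Fp L) a') (JW_eq (Fp L) L a')) (undoubledSplittings L (Equiv.prodUnique (Fin 2) (Fin 1)) dV hdV hdV0 (lineW L (TW (Fp L) a')) (complexConj_lineW L (TW (Fp L) a')) (lineW_ne_zero L (TW (Fp L) a') (isUnit_det_TW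 (Fp L) a')) (toHeckeCharacter L lam) (borelPlaceMeasure L) (cmFinLocalFamily L (Equiv.prodUnique (Fin 2) (Fin 1)) dV hdV hdV0 (lineW L (TW (Fp L) a')) (complexConj_lineW L (TW (Fp L) a')) (lineW_ne_zero L (TW (Fp L) a') (isUnit_det_TW (Fp L) a')) (toHeckeCharacter L lam) ((isOscillatorChar_toHeckeCharacter_iff lam).mpr hlam) (borelPlaceMeasure L))) (isSymm_TW (Fp L) a') (JW_eq (Fp L) L a')).s v) ((congrW L (Equiv.prodUnique (Fin 2) (Fin 1)) dV hdV (lineW L (TW (Fp L) a')) (complexConj_lineW L (TW (Fp L) a')) (realDiagonal_lineW L (TW (Fp L) a')) (diagonal_lineW L (TW (Fp L) a') (JW_eq (Fp L) L a')) (undoubledSplittings L (Equiv.prodUnique (Fin 2) (Fin 1)) dV hdV hdV0 (lineW L (TW (Fp L) a')) (complexConj_lineW L (TW (Fp L) a')) (lineW_ne_zero L (TW (Fp L) a') (isUnit_det_TW (Fp L) a')) (toHeckeCharacter L lam) (borelPlaceMeasure L) (cmFinLocalFamily L (Equiv.prodUnique (Fin 2) (Fin 1)) dV hdV hdV0 (lineW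 L (TW (Fp L) a')) (complexConj_lineW L (TW (Fp L) a')) (lineW_ne_zero L (TW (Fp L) a') (isUnit_det_TW (Fp L) a')) (toHeckeCharacter L lam) ((isOscillatorChar_toHeckeCharacter_iff lam).mpr hlam) (borelPlaceMeasure L))) (isSymm_TW (Fp L) a') (JW_eq (Fp L) L a')).proj_s v)))
          (fun g z => (show Commute g (localCenter L (IsCMField.complexConj L) 2 (Matrix.diagonal dV) (JW (Fp L) L a') (JW_apply_ne_zero (Fp L) L a') v z) from
            localCenter_comm L (IsCMField.complexConj L) 2 (Matrix.diagonal dV) (JW (Fp L) L a') (JW_apply_ne_zero (Fp L) L a') v z g).map ((MpPsi.toRep (localSchrodinger (Fp L) 2 (realDiagonal L dV hdV) v)).comp (lineTransportSection (Fp L) L (IsCMField.complexConj L) 2 (complexConj_imagUnit L) (imagUnit_ne_zero L) (imagUnit_mul_self L) (realDiagonal L dV hdV) (realDiagonal_isSymm L dV hdV) (Matrix.diagonal dV) (realDiagonal_map L dV hdV).symm a' v ((congrW L (Equiv.prodUnique (Fin 2) (Fin 1)) dV hdV (lineW L (TW (Fp L) a')) (complexConj_lineW L (TW (Fp L) a'))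 (realDiagonal_lineW L (TW (Fp L) a')) (diagonal_lineW L (TW (Fp L) a') (JW_eq (Fp L) L a')) (undoubledSplittings L (Equiv.prodUnique (Fin 2) (Fin 1)) dV hdV hdV0 (lineW L (TW (Fp L) a')) (complexConj_lineW L (TW (Fp L) a')) (lineW_ne_zero L (TW (Fp L) a') (isUnit_det_TW (Fp L) a')) (toHeckeCharacter L lam) (borelPlaceMeasure L) (cmFinLocalFamily L (Equiv.prodUnique (Fin 2) (Fin 1)) dV hdV hdV0 (lineW L (TW (Fp L) a')) (complexConj_lineW L (TW (Fp L) a')) (lineW_ne_zero L (TW (Fp L) a') (isUnit_det_TW (Fp L) a')) (toHeckeCharacter L lam) ((isOscillatorChar_toHeckeCharacter_iff lam).mpr hlam) (borelPlaceMeasure L))) (isSymm_TW (Fp L) a') (JW_eq (Fp L) L a')).s v) ((congrW L (Equiv.prodUnique (Fin 2) (Fin 1)) dV hdV (lineW L (TW (Fp L) a')) (complexConj_lineW L (TW (Fp L) a')) (realDiagonal_lineW L (TW (Fp L) a')) (diagonal_lineW L (TW (Fp L) a') (JW_eq (Fp L) L a')) (undoubledSplittings L (Equiv.prodUnique (Fin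 2) (Fin 1)) dV hdV hdV0 (lineW L (TW (Fp L) a')) (complexConj_lineW L (TW (Fp L) a')) (lineW_ne_zero L (TW (Fp L) a') (isUnit_det_TW (Fp L) a')) (toHeckeCharacter L lam) (borelPlaceMeasure L) (cmFinLocalFamily L (Equiv.prodUnique (Fin 2) (Fin 1)) dV hdV hdV0 (lineW L (TW (Fp L) a')) (complexConj_lineW L (TW (Fp L) a')) (lineW_ne_zero L (TW (Fp L) a') (isUnit_det_TW (Fp L) a')) (toHeckeCharacter L lam) ((isOscillatorChar_toHeckeCharacter_iff lam).mpr hlam) (borelPlaceMeasure L))) (isSymm_TW (Fp L) a') (JW_eq (Fp L) L a')).proj_s v)))))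
        (TwistedCoinv.rep
          (ρW := show Representation ℂ (localPi L (IsCMField.complexConj L) 1 (JW (Fp L) L a') v) (SchwartzBruhat (Fin 2 → v.adicCompletion (Fp L))) from
            ((MpPsi.toRep (localSchrodinger (Fp L) 2 (realDiagonal L dV hdV) v)).comp (lineTransportSection (Fp L) L (IsCMField.complexConj L) 2 (complexConj_imagUnit L) (imagUnit_ne_zero L) (imagUnit_mul_self L) (realDiagonal L dV hdV) (realDiagonal_isSymm L dV hdV) (Matrix.diagonal dV) (realDiagonal_map L dV hdV).symm a v ((congrW L (Equiv.prodUnique (Fin 2) (Fin 1)) dV hdV (lineW L (TW (Fp L) a)) (complexConj_lineW L (TW (Fp L) a)) (realDiagonal_lineW L (TW (Fp L) a)) (diagonal_lineW L (TW (Fp L) a) (JW_eq (Fp L) L a)) (undoubledSplittings L (Equiv.prodUnique (Fin 2) (Fin 1)) dV hdV hdV0 (lineW L (TW (Fp L) a)) (complexConj_lineW L (TW (Fp L) a)) (lineW_ne_zero L (TW (Fp L) a) (isUnit_det_TW (Fp L) a)) (toHeckeCharacter L lam) (borelPlaceMeasure L) (cmFinLocalFamily L (Equiv.prodUnique (Fin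 2) (Fin 1)) dV hdV hdV0 (lineW L (TW (Fp L) a)) (complexConj_lineW L (TW (Fp L) a)) (lineW_ne_zero L (TW (Fp L) a) (isUnit_det_TW (Fp L) a)) (toHeckeCharacter L lam) ((isOscillatorChar_toHeckeCharacter_iff lam).mpr hlam) (borelPlaceMeasure L))) (isSymm_TW (Fp L) a) (JW_eq (Fp L) L a)).s v) ((congrW L (Equiv.prodUnique (Fin 2) (Fin 1)) dV hdV (lineW L (TW (Fp L) a)) (complexConj_lineW L (TW (Fp L) a)) (realDiagonal_lineW L (TW (Fp L) a)) (diagonal_lineW L (TW (Fp L) a) (JW_eq (Fp L) L a)) (undoubledSplittings L (Equiv.prodUnique (Fin 2) (Fin 1)) dV hdV hdV0 (lineW L (TW (Fp L) a)) (complexConj_lineW L (TW (Fp L) a)) (lineW_ne_zero L (TW (Fp L) a) (isUnit_det_TW (Fp L) a)) (toHeckeCharacter L lam) (borelPlaceMeasure L) (cmFinLocalFamily L (Equiv.prodUnique (Fin 2) (Fin 1)) dV hdV hdV0 (lineW L (TW (Fp L) a)) (complexConj_lineW L (TW (Fp L) a)) (lineW_ne_zero L (TW (Fp L) a) (isUnit_det_TW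 (Fp L) a)) (toHeckeCharacter L lam) ((isOscillatorChar_toHeckeCharacter_iff lam).mpr hlam) (borelPlaceMeasure L))) (isSymm_TW (Fp L) a) (JW_eq (Fp L) L a)).proj_s v))).comp (localCenter L (IsCMField.complexConj L) 2 (Matrix.diagonal dV) (JW (Fp L) L a') (JW_apply_ne_zero (Fp L) L a') v))
          (localCharOfCenter (Fp L) L (IsCMField.complexConj L) (JW (Fp L) L a') (JW_apply_ne_zero (Fp L) L a') χ.1 v)
          ((MpPsi.toRep (localSchrodinger (Fp L) 2 (realDiagonal L dV hdV) v)).comp (lineTransportSection (Fp L) L (IsCMField.complexConj L) 2 (complexConj_imagUnit L) (imagUnit_ne_zero L) (imagUnit_mul_self L) (realDiagonal L dV hdV) (realDiagonal_isSymm L dV hdV) (Matrix.diagonal dV) (realDiagonal_map L dV hdV).symm a v ((congrW L (Equiv.prodUnique (Fin 2) (Fin 1)) dV hdV (lineW L (TW (Fp L) a)) (complexConj_lineW L (TW (Fp L) a)) (realDiagonal_lineW L (TW (Fp L) a)) (diagonal_lineW L (TW (Fp L) a) (JW_eq (Fp L) L a)) (undoubledSplittings L (Equiv.prodUnique (Fin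 2) (Fin 1)) dV hdV hdV0 (lineW L (TW (Fp L) a)) (complexConj_lineW L (TW (Fp L) a)) (lineW_ne_zero L (TW (Fp L) a) (isUnit_det_TW (Fp L) a)) (toHeckeCharacter L lam) (borelPlaceMeasure L) (cmFinLocalFamily L (Equiv.prodUnique (Fin 2) (Fin 1)) dV hdV hdV0 (lineW L (TW (Fp L) a)) (complexConj_lineW L (TW (Fp L) a)) (lineW_ne_zero L (TW (Fp L) a) (isUnit_det_TW (Fp L) a)) (toHeckeCharacter L lam) ((isOscillatorChar_toHeckeCharacter_iff lam).mpr hlam) (borelPlaceMeasure L))) (isSymm_TW (Fp L) a) (JW_eq (Fp L) L a)).s v) ((congrW L (Equiv.prodUnique (Fin 2) (Fin 1)) dV hdV (lineW L (TW (Fp L) a)) (complexConj_lineW L (TW (Fp L) a)) (realDiagonal_lineW L (TW (Fp L) a)) (diagonal_lineW L (TW (Fp L) a) (JW_eq (Fp L) L a)) (undoubledSplittings L (Equiv.prodUnique (Fin 2) (Fin 1)) dV hdV hdV0 (lineW L (TW (Fp L) a)) (complexConj_lineW L (TW (Fp L) a)) (lineW_ne_zero L (TW (Fp L) a) (isUnit_det_TW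 (Fp L) a)) (toHeckeCharacter L lam) (borelPlaceMeasure L) (cmFinLocalFamily L (Equiv.prodUnique (Fin 2) (Fin 1)) dV hdV hdV0 (lineW L (TW (Fp L) a)) (complexConj_lineW L (TW (Fp L) a)) (lineW_ne_zero L (TW (Fp L) a) (isUnit_det_TW (Fp L) a)) (toHeckeCharacter L lam) ((isOscillatorChar_toHeckeCharacter_iff lam).mpr hlam) (borelPlaceMeasure L))) (isSymm_TW (Fp L) a) (JW_eq (Fp L) L a)).proj_s v)))
          (fun g z => (show Commute g (localCenter L (IsCMField.complexConj L) 2 (Matrix.diagonal dV) (JW (Fp L) L a') (JW_apply_ne_zero (Fp L) L a') v z) from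
            localCenter_comm L (IsCMField.complexConj L) 2 (Matrix.diagonal dV) (JW (Fp L) L a') (JW_apply_ne_zero (Fp L) L a') v z g).map ((MpPsi.toRep (localSchrodinger (Fp L) 2 (realDiagonal L dV hdV) v)).comp (lineTransportSection (Fp L) L (IsCMField.complexConj L) 2 (complexConj_imagUnit L) (imagUnit_ne_zero L) (imagUnit_mul_self L) (realDiagonal L dV hdV) (realDiagonal_isSymm L dV hdV) (Matrix.diagonal dV) (realDiagonal_map L dV hdV).symm a v ((congrW L (Equiv.prodUnique (Fin 2) (Fin 1)) dV hdV (lineW L (TW (Fp L) a)) (complexConj_lineW L (TW (Fp L) a)) (realDiagonal_lineW L (TW (Fp L) a)) (diagonal_lineW L (TW (Fp L) a) (JW_eq (Fp L) L a)) (undoubledSplittings L (Equiv.prodUnique (Fin 2) (Fin 1)) dV hdV hdV0 (lineW L (TW (Fp L) a)) (complexConj_lineW L (TW (Fp L) a)) (lineW_ne_zero L (TW (Fp L) a) (isUnit_det_TW (Fp L) a)) (toHeckeCharacter L lam) (borelPlaceMeasure L) (cmFinLocalFamily L (Equiv.prodUnique (Fin 2) (Fin 1)) dV hdV hdV0 (lineW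 L (TW (Fp L) a)) (complexConj_lineW L (TW (Fp L) a)) (lineW_ne_zero L (TW (Fp L) a) (isUnit_det_TW (Fp L) a)) (toHeckeCharacter L lam) ((isOscillatorChar_toHeckeCharacter_iff lam).mpr hlam) (borelPlaceMeasure L))) (isSymm_TW (Fp L) a) (JW_eq (Fp L) L a)).s v) ((congrW L (Equiv.prodUnique (Fin 2) (Fin 1)) dV hdV (lineW L (TW (Fp L) a)) (complexConj_lineW L (TW (Fp L) a)) (realDiagonal_lineW L (TW (Fp L) a)) (diagonal_lineW L (TW (Fp L) a) (JW_eq (Fp L) L a)) (undoubledSplittings L (Equiv.prodUnique (Fin 2) (Fin 1)) dV hdV hdV0 (lineW L (TW (Fp L) a)) (complexConj_lineW L (TW (Fp L) a)) (lineW_ne_zero L (TW (Fp L) a) (isUnit_det_TW (Fp L) a)) (toHeckeCharacter L lam) (borelPlaceMeasure L) (cmFinLocalFamily L (Equiv.prodUnique (Fin 2) (Fin 1)) dV hdV hdV0 (lineW L (TW (Fp L) a)) (complexConj_lineW L (TW (Fp L) a)) (lineW_ne_zero L (TW (Fp L) a) (isUnit_det_TW (Fp L) a)) (toHeckeCharacter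 L lam) ((isOscillatorChar_toHeckeCharacter_iff lam).mpr hlam) (borelPlaceMeasure L))) (isSymm_TW (Fp L) a) (JW_eq (Fp L) L a)).proj_s v))))) →
      False)
 :
    LemD1_4SameLabelNonsplitCM₂ := by
  intro L _ _ _ dV hdV hdV0 n' e₁ lam hlam hw a a' χ v hns hi_a' hiso
  by_cases hV : LemD1.IsIsotropic (LemD1OfPlace.standingData L v (IsCMField.complexConj L) 2 (Matrix.diagonal dV) (complexConj_imagUnit L)
          (imagUnit_ne_zero L) le_rfl
          (transpose_map_conj_JV (Fp L) L (IsCMField.complexConj L) 2 (Matrix.diagonal dV) (realDiagonal_isSymm L dV hdV) (realDiagonal_map L dV hdV).symm)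
          (det_JV_ne_zero (Fp L) L 2 (Matrix.diagonal dV) (isUnit_det_realDiagonal L dV hdV hdV0) (realDiagonal_map L dV hdV).symm))
  · exact locF_apply_eq_of_equiv_localTypes_nonsplit_of_isIsotropic L dV hdV hdV0 e₁ lam hlam a a' χ v hns hV hiso
  · exact locF_apply_eq_of_equiv_localTypes_nonsplit_of_separation L dV hdV hdV0 e₁ lam hlam a a' χ v
      (hsepA L dV hdV hdV0 lam hlam hw a a' χ v hns hV) hi_a' hiso

end Summit.HodgeConjecture.HodgeConjecture.Cruxes.HLiu418.F0LD1SameLabelRigidityOfOrgan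

end
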